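import Summits.Langlands.Langlands.Theorems.PicardMuOrdinaryMuOrdinaryFamilyRTCharZeroDefs
import HarnessLib

/-!
# Crux `MuOrdinaryFamilyRT` (stmt-Langlands-13757), line `thorne-minimal-lift`:
# glue gω — the `3`-adic cyclotomic character is residually trivial over any `K`-algebra `F'`

Registered glue stub `toZMod_cyclotomicCharacter_zpow_eq_one` of the lead's v7 reduction of
`stub_pointAutomorphicT` (blueprint `Cruxes/MuOrdinaryFamilyRT/Lines/thorne-minimal-lift-pointAutomorphic.md`):
for every number field `F'` that is a `K`-algebra (`K = ℚ(ζ₃)`), every `m ∈ ℤ` and every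
`σ ∈ Γ_{F'}`, the unit `ε(σ) ^ (-2 - m) ∈ ℤ₃ˣ` reduces to `1` modulo `3`.

Proof.  `ζ₃ ∈ K ⊆ F' ⊆ F̄'` is a primitive cube root of unity fixed by `σ` (`σ` is `F'`-linear), and
by the defining property of the cyclotomic character (`GaloisRep.cyclotomicCharacter_spec`, i.e.
Mathlib's `cyclotomicCharacter.spec`) `σ ζ₃ = ζ₃ ^ (ε(σ) mod 3)`; hence `ε(σ) mod 3 = 1` in `ℤ/3¹`
(`IsPrimitiveRoot.pow_inj`), i.e. `ε(σ) - 1 ∈ (3) = 𝔪_{ℤ₃}` (`PadicInt.ker_toZModPow`,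
`PadicInt.maximalIdeal_eq_span_p`, `PadicInt.ker_toZMod`), so `PadicInt.toZMod (ε σ) = 1`, and the
same for every integer power through the monoid map `Units.map PadicInt.toZMod` (`map_zpow`).
-/

set_option linter.dupNamespace false

namespace Summit.Langlands.Langlands.Cruxes.MuOrdinaryFamilyRT.ThorneMinimalLift

open scoped NumberField Polynomial Matrix Classical
open Field IsDedekindDomain Polynomial
open Literature.NumberTheory.GaloisRepresentations Literature.NumberTheory.Automorphic
open Summit.Langlands.Langlands.Cruxes.MuOrdinaryFamilyRT.CharZeroDominance

noncomputable section

/-- `ε ≡ 1 (mod 3)` on `Γ_{F'}` for any `K`-algebra `F'` (`K = ℚ(ζ₃)`): `σ ∈ Γ_{F'}` fixes the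
primitive cube root of unity `ζ₃ ∈ K ⊆ F' ⊆ F̄'`, so `PadicInt.toZMod (ε σ) = 1`. -/
theorem toZMod_cyclotomicCharacter_eq_one (F' : Type) [Field F'] [NumberField F'] [Algebra K F']
    (σ : absoluteGaloisGroup F') :
    PadicInt.toZMod ((GaloisRep.cyclotomicCharacter F' 3 σ : ℤ_[3]ˣ) : ℤ_[3]) = 1 := by
  haveI : IsCyclotomicExtension {3} ℚ K := CyclotomicField.isCyclotomicExtension 3 ℚ
  set t : AlgebraicClosure F' :=
    algebraMap F' (AlgebraicClosure F') (algebraMap K F' (IsCyclotomicExtension.zeta 3 ℚ K)) with ht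
  have hprim : IsPrimitiveRoot t 3 :=
    ((IsCyclotomicExtension.zeta_spec 3 ℚ K).map_of_injective (algebraMap K F').injective).map_of_injective
      (algebraMap F' (AlgebraicClosure F')).injective
  have ht3 : t ^ 3 ^ 1 = 1 := by rw [pow_one]; exact hprim.pow_eq_one
  have hfix : σ • t = t := by
    rw [absoluteGaloisGroup.smul_def, ht, AlgEquiv.commutes]
  have hspec := GaloisRep.cyclotomicCharacter_spec F' 3 σ t ht3
  rw [hfix] at hspec
  set u : ℤ_[3]ˣ := GaloisRep.cyclotomicCharacter F' 3 σ with hu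
  set a := ((u : ℤ_[3]).toZModPow 1) with ha
  have hlt : a.val < 3 := by
    have := a.val_lt
    simpa using this
  have ha1 : a.val = 1 :=
    hprim.pow_inj hlt (by norm_num) (hspec.symm.trans (pow_one t).symm)
  have ha1' : a = 1 := by
    rw [← ZMod.natCast_zmod_val a, ha1, Nat.cast_one]
  have hker : (u : ℤ_[3]) - 1 ∈ RingHom.ker (PadicInt.toZModPow 1 : ℤ_[3] →+* ZMod (3 ^ 1)) := by
    rw [RingHom.mem_ker, map_sub, map_one, ← ha, ha1', sub_self]
  rw [PadicInt.ker_toZModPow, pow_one, ← PadicInt.maximalIdeal_eq_span_p, ← PadicInt.ker_toZMod,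
    RingHom.mem_ker, map_sub, map_one, sub_eq_zero] at hker
  exact hker

/-- **Glue gω.**  For every number field `F'` that is a `K`-algebra (`K = ℚ(ζ₃)`), every `m ∈ ℤ`
and every `σ ∈ Γ_{F'}`: `ε(σ) ^ (-2 - m) ≡ 1 (mod 3)`, i.e. `PadicInt.toZMod (ε(σ) ^ (-2 - m)) = 1`
(`toZMod_cyclotomicCharacter_eq_one` pushed through the monoid map `Units.map PadicInt.toZMod`). -/
theorem toZMod_cyclotomicCharacter_zpow_eq_one : ∀ (F' : Type) [Field F'] [NumberField F'] [Algebra K F'] (m : ℤ) (σ : absoluteGaloisGroup F'), PadicInt.toZMod (((GaloisRep.cyclotomicCharacter F' 3 σ) ^ (-2 - m) : ℤ_[3]ˣ) : ℤ_[3]) = 1 := by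
  intro F' _ _ _ m σ
  set u : ℤ_[3]ˣ := GaloisRep.cyclotomicCharacter F' 3 σ with hu
  have hunit : Units.map (PadicInt.toZMod : ℤ_[3] →+* ZMod 3).toMonoidHom u = 1 :=
    Units.ext (toZMod_cyclotomicCharacter_eq_one F' σ)
  have : PadicInt.toZMod ((u ^ (-2 - m) : ℤ_[3]ˣ) : ℤ_[3]) =
      ((Units.map (PadicInt.toZMod : ℤ_[3] →+* ZMod 3).toMonoidHom (u ^ (-2 - m)) : (ZMod 3)ˣ) : ZMod 3) := rfl
  rw [this, map_zpow, hunit, one_zpow, Units.val_one]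

end

end Summit.Langlands.Langlands.Cruxes.MuOrdinaryFamilyRT.ThorneMinimalLift
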